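import Summits.BirchSwinnertonDyer.BirchSwinnertonDyer.Theorems.ResidualThetaTransportAtTwoSignedMuSeedAtTwoPlusJetInverse
import HarnessLib

/-!
# The card's collapses `c₁ = s₁²`, `c₃ = s₁⁴`, `c₅ = c₂²`, `c₇ = s₁⁸` for `Φ_{Q′} = Σ_P 1/(x(Q′ ⊕ T(t)) − x_P)` (seed line
# `jet-character-sums`, crux `SignedMuSeedAtTwoPlus` stmt-BirchSwinnertonDyer-21438; Kμ⁺ stmt-BirchSwinnertonDyer-20689;
# route `ResidualThetaTransportAtTwo`) — summed over the points `P` from the per-point jets of `…JetInverse`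

Cell `bsd-wall`, width seat `bsd-wall-rtt-p4-w2` (g12). THEOREMS ONLY (no `def`, no named fact, no `sorry`); helper `--supports` the
seed crux; nothing about any curve, character sum or `μ`-invariant is asserted; BSD is not proved by this. Sequel of `…JetTranslation`
(p671421: the translation jet `q`), `…JetInverse` (p672221: the `7`-jet of each `φ_P = 1/(d_P + q)`, `d_P = x′ − x_P`, `d_P e_P = 1`) and
`…JetFrobeniusCollapse` (p671596: Frobenius additivity). For a finite family of points `P ∈ s` sharing the SAME translation jet `q`
(it depends on `Q′` only) the sum `Φ = Σ_P φ_P` has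

* `coeff_one_sum_inv_jet`: `[t¹]Φ = (Σ e_P)² = s₁²`; `coeff_three_sum_inv_jet`: `[t³]Φ = s₁⁴`; `coeff_seven_sum_inv_jet`: `[t⁷]Φ = s₁⁸`;
* `coeff_five_sum_inv_jet`: `[t⁵]Φ = ([t²]Φ)²` (`c₅ = c₂²`), where `[t²]Φ = Σ_P (e_P³ + a e_P²) = s₃ + a s₂` (`s_j = Σ_P e_P^j`);
* `jetCollapse_sum` — the four collapses in one statement (the card's Lever (i) «`c₁ = s₁²`, `c₃ = s₁⁴`, `c₅ = c₂²`, `c₇ = s₁⁸`» VERBATIM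
  up to notation, per `Q′`; the further sum over the `χ̄₀`-orbit with rotations is the tilt dictionary's business).

References: the card `Cruxes/SignedMuSeedAtTwoPlus/Ideas/jet-character-sums.md` (Lever (i)); [SilvermanAEC2009] IV.1.1.
-/

set_option autoImplicit false
set_option linter.dupNamespace false

noncomputable section

open PowerSeries Finset

namespace Summit.BirchSwinnertonDyer.BirchSwinnertonDyer.Theorems.SignedMuAtTwo.JetCharacterSums

variable {R : Type*} [CommRing R] [CharP R 2] {ι : Type*}

/-- **`c₁ = s₁²`, `c₂ = s₃ + a s₂`, `c₃ = s₁⁴`, `c₅ = c₂²`, `c₇ = s₁⁸`** for `Φ = Σ_{P ∈ s} φ_P`, `φ_P (C d_P + q) = 1`, `d_P e_P = 1`,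
`q ≡ X + aX² + (1+b)X⁴ + a²X⁶ (mod X⁸)` (characteristic `2`; `s_j = Σ_P e_P^j`). [cite: SilvermanAEC2009, IV.1.1] -/
theorem jetCollapse_sum (s : Finset ι) (d e : ι → R) (hde : ∀ i ∈ s, d i * e i = 1) {a b : R} {q : R⟦X⟧}
    (hq : X ^ 8 ∣ q - (X + C a * X ^ 2 + C (1 + b) * X ^ 4 + C (a ^ 2) * X ^ 6)) (φ : ι → R⟦X⟧)
    (hφ : ∀ i ∈ s, φ i * (C (d i) + q) = 1) :
    coeff 1 (∑ i ∈ s, φ i) = (∑ i ∈ s, e i) ^ 2 ∧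
      coeff 2 (∑ i ∈ s, φ i) = ∑ i ∈ s, (e i ^ 3 + a * e i ^ 2) ∧
      coeff 3 (∑ i ∈ s, φ i) = (∑ i ∈ s, e i) ^ 4 ∧
      coeff 5 (∑ i ∈ s, φ i) = (coeff 2 (∑ i ∈ s, φ i)) ^ 2 ∧
      coeff 7 (∑ i ∈ s, φ i) = (∑ i ∈ s, e i) ^ 8 := by
  -- per-point jets
  have hj : ∀ i ∈ s, coeff 1 (φ i) = e i ^ 2 ∧ coeff 2 (φ i) = e i ^ 3 + a * e i ^ 2 ∧ coeff 3 (φ i) = e i ^ 4 ∧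
      coeff 5 (φ i) = e i ^ 6 + a ^ 2 * e i ^ 4 ∧ coeff 7 (φ i) = e i ^ 8 := by
    intro i hi
    obtain ⟨-, h1, h2, h3, -, h5, -, h7⟩ := coeff_inv_jet (hde i hi) hq (hφ i hi)
    exact ⟨h1, h2, h3, h5, h7⟩
  have c1 : coeff 1 (∑ i ∈ s, φ i) = ∑ i ∈ s, e i ^ 2 := by
    rw [map_sum]; exact Finset.sum_congr rfl fun i hi => (hj i hi).1
  have c2 : coeff 2 (∑ i ∈ s, φ i) = ∑ i ∈ s, (e i ^ 3 + a * e i ^ 2) := by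
    rw [map_sum]; exact Finset.sum_congr rfl fun i hi => (hj i hi).2.1
  have c3 : coeff 3 (∑ i ∈ s, φ i) = ∑ i ∈ s, e i ^ 4 := by
    rw [map_sum]; exact Finset.sum_congr rfl fun i hi => (hj i hi).2.2.1
  have c5 : coeff 5 (∑ i ∈ s, φ i) = ∑ i ∈ s, (e i ^ 6 + a ^ 2 * e i ^ 4) := by
    rw [map_sum]; exact Finset.sum_congr rfl fun i hi => (hj i hi).2.2.2.1
  have c7 : coeff 7 (∑ i ∈ s, φ i) = ∑ i ∈ s, e i ^ 8 := by
    rw [map_sum]; exact Finset.sum_congr rfl fun i hi => (hj i hi).2.2.2.2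
  -- Frobenius: `(Σ e)² = Σ e²`, iterated
  have f2 : (∑ i ∈ s, e i) ^ 2 = ∑ i ∈ s, e i ^ 2 := CharTwo.sum_sq s e
  have f4 : (∑ i ∈ s, e i) ^ 4 = ∑ i ∈ s, e i ^ 4 := by
    rw [show (4 : ℕ) = 2 * 2 by norm_num, pow_mul, f2, CharTwo.sum_sq]
    exact Finset.sum_congr rfl fun i _ => by ring
  have f8 : (∑ i ∈ s, e i) ^ 8 = ∑ i ∈ s, e i ^ 8 := by
    rw [show (8 : ℕ) = 4 * 2 by norm_num, pow_mul, f4, CharTwo.sum_sq]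
    exact Finset.sum_congr rfl fun i _ => by ring
  have htwo : (2 : R) = 0 := CharTwo.two_eq_zero
  have f5 : (∑ i ∈ s, (e i ^ 3 + a * e i ^ 2)) ^ 2 = ∑ i ∈ s, (e i ^ 6 + a ^ 2 * e i ^ 4) := by
    rw [CharTwo.sum_sq]
    exact Finset.sum_congr rfl fun i _ => by linear_combination (a * e i ^ 5) * htwo
  refine ⟨c1.trans f2.symm, c2, c3.trans f4.symm, ?_, c7.trans f8.symm⟩
  rw [c5, c2, f5]

/-- `c₁ = s₁²`. [cite: SilvermanAEC2009, IV.1.1] -/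
theorem coeff_one_sum_inv_jet (s : Finset ι) (d e : ι → R) (hde : ∀ i ∈ s, d i * e i = 1) {a b : R} {q : R⟦X⟧}
    (hq : X ^ 8 ∣ q - (X + C a * X ^ 2 + C (1 + b) * X ^ 4 + C (a ^ 2) * X ^ 6)) (φ : ι → R⟦X⟧)
    (hφ : ∀ i ∈ s, φ i * (C (d i) + q) = 1) : coeff 1 (∑ i ∈ s, φ i) = (∑ i ∈ s, e i) ^ 2 :=
  (jetCollapse_sum s d e hde hq φ hφ).1

/-- `c₃ = s₁⁴`. [cite: SilvermanAEC2009, IV.1.1] -/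
theorem coeff_three_sum_inv_jet (s : Finset ι) (d e : ι → R) (hde : ∀ i ∈ s, d i * e i = 1) {a b : R} {q : R⟦X⟧}
    (hq : X ^ 8 ∣ q - (X + C a * X ^ 2 + C (1 + b) * X ^ 4 + C (a ^ 2) * X ^ 6)) (φ : ι → R⟦X⟧)
    (hφ : ∀ i ∈ s, φ i * (C (d i) + q) = 1) : coeff 3 (∑ i ∈ s, φ i) = (∑ i ∈ s, e i) ^ 4 :=
  (jetCollapse_sum s d e hde hq φ hφ).2.2.1

/-- `c₅ = c₂²`. [cite: SilvermanAEC2009, IV.1.1] -/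
theorem coeff_five_sum_inv_jet (s : Finset ι) (d e : ι → R) (hde : ∀ i ∈ s, d i * e i = 1) {a b : R} {q : R⟦X⟧}
    (hq : X ^ 8 ∣ q - (X + C a * X ^ 2 + C (1 + b) * X ^ 4 + C (a ^ 2) * X ^ 6)) (φ : ι → R⟦X⟧)
    (hφ : ∀ i ∈ s, φ i * (C (d i) + q) = 1) : coeff 5 (∑ i ∈ s, φ i) = (coeff 2 (∑ i ∈ s, φ i)) ^ 2 :=
  (jetCollapse_sum s d e hde hq φ hφ).2.2.2.1

/-- `c₇ = s₁⁸`. [cite: SilvermanAEC2009, IV.1.1] -/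
theorem coeff_seven_sum_inv_jet (s : Finset ι) (d e : ι → R) (hde : ∀ i ∈ s, d i * e i = 1) {a b : R} {q : R⟦X⟧}
    (hq : X ^ 8 ∣ q - (X + C a * X ^ 2 + C (1 + b) * X ^ 4 + C (a ^ 2) * X ^ 6)) (φ : ι → R⟦X⟧)
    (hφ : ∀ i ∈ s, φ i * (C (d i) + q) = 1) : coeff 7 (∑ i ∈ s, φ i) = (∑ i ∈ s, e i) ^ 8 :=
  (jetCollapse_sum s d e hde hq φ hφ).2.2.2.2

/-! ## The even jets `c₄`, `c₆` (appended; the card's formulas, the second of which holds exactly ON the curve) -/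

/-- **The even jets of `Φ = Σ_P φ_P`** (characteristic `2`, hypotheses of `jetCollapse_sum`):
`c₄ = (1+b)·s₁² + a²·s₃ + a·s₁⁴ + s₅` and `c₆ = a²·s₁² + a·s₃² + (a³ + 1 + b)·s₁⁴ + s₇` (`s_j = Σ_P e_P^j`; `s₂ = s₁²`,
`s₄ = s₁⁴`, `s₆ = s₃²` by Frobenius). With `a = x′²`, `b = y′²` the first is the card's `c₄ = s₁²(y′²+1) + s₃x′⁴ + s₁⁴x′² + s₅`
for EVERY `(x′, y′)`. [cite: SilvermanAEC2009, IV.1.1] -/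
theorem jetEven_sum (s : Finset ι) (d e : ι → R) (hde : ∀ i ∈ s, d i * e i = 1) {a b : R} {q : R⟦X⟧}
    (hq : X ^ 8 ∣ q - (X + C a * X ^ 2 + C (1 + b) * X ^ 4 + C (a ^ 2) * X ^ 6)) (φ : ι → R⟦X⟧)
    (hφ : ∀ i ∈ s, φ i * (C (d i) + q) = 1) :
    coeff 4 (∑ i ∈ s, φ i) =
        (1 + b) * (∑ i ∈ s, e i) ^ 2 + a ^ 2 * ∑ i ∈ s, e i ^ 3 + a * (∑ i ∈ s, e i) ^ 4 + ∑ i ∈ s, e i ^ 5 ∧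
      coeff 6 (∑ i ∈ s, φ i) =
        a ^ 2 * (∑ i ∈ s, e i) ^ 2 + a * (∑ i ∈ s, e i ^ 3) ^ 2 + (a ^ 3 + 1 + b) * (∑ i ∈ s, e i) ^ 4 +
          ∑ i ∈ s, e i ^ 7 := by
  have hj : ∀ i ∈ s, coeff 4 (φ i) = e i ^ 5 + a * e i ^ 4 + a ^ 2 * e i ^ 3 + (1 + b) * e i ^ 2 ∧
      coeff 6 (φ i) = e i ^ 7 + a * e i ^ 6 + (a ^ 3 + 1 + b) * e i ^ 4 + a ^ 2 * e i ^ 2 := by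
    intro i hi
    obtain ⟨-, -, -, -, h4, -, h6, -⟩ := coeff_inv_jet (hde i hi) hq (hφ i hi)
    exact ⟨h4, h6⟩
  have c4 : coeff 4 (∑ i ∈ s, φ i) = ∑ i ∈ s, (e i ^ 5 + a * e i ^ 4 + a ^ 2 * e i ^ 3 + (1 + b) * e i ^ 2) := by
    rw [map_sum]; exact Finset.sum_congr rfl fun i hi => (hj i hi).1
  have c6 : coeff 6 (∑ i ∈ s, φ i) = ∑ i ∈ s, (e i ^ 7 + a * e i ^ 6 + (a ^ 3 + 1 + b) * e i ^ 4 + a ^ 2 * e i ^ 2) := by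
    rw [map_sum]; exact Finset.sum_congr rfl fun i hi => (hj i hi).2
  -- Frobenius
  have f2 : (∑ i ∈ s, e i) ^ 2 = ∑ i ∈ s, e i ^ 2 := CharTwo.sum_sq s e
  have f4 : (∑ i ∈ s, e i) ^ 4 = ∑ i ∈ s, e i ^ 4 := by
    rw [show (4 : ℕ) = 2 * 2 by norm_num, pow_mul, f2, CharTwo.sum_sq]
    exact Finset.sum_congr rfl fun i _ => by ring
  have f6 : (∑ i ∈ s, e i ^ 3) ^ 2 = ∑ i ∈ s, e i ^ 6 := by
    rw [CharTwo.sum_sq]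
    exact Finset.sum_congr rfl fun i _ => by ring
  constructor
  · rw [c4, f2, f4, Finset.mul_sum, Finset.mul_sum, Finset.mul_sum, ← Finset.sum_add_distrib, ← Finset.sum_add_distrib,
      ← Finset.sum_add_distrib]
    exact Finset.sum_congr rfl fun i _ => by ring
  · rw [c6, f2, f4, f6, Finset.mul_sum, Finset.mul_sum, Finset.mul_sum, ← Finset.sum_add_distrib, ← Finset.sum_add_distrib,
      ← Finset.sum_add_distrib]
    exact Finset.sum_congr rfl fun i _ => by ring

/-- **The card's `c₄`, `c₆` VERBATIM, for `Q′ = (x′, y′)` ON the curve `y′² + y′ = x′³`** (`a = x′²`, `b = y′²`):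
`c₄ = s₁²(y′²+1) + s₃x′⁴ + s₁⁴x′² + s₅` and `c₆ = s₁²x′⁴ + s₁⁴(y′⁴+1) + s₃²x′² + s₇`. The curve equation is used exactly once,
to rewrite `x′⁶ + 1 + y′²` as `y′⁴ + 1` in `c₆` (in characteristic `2`); `c₄` holds for every `(x′, y′)`. [cite: SilvermanAEC2009, IV.1.1] -/
theorem jetEven_sum_of_equation (s : Finset ι) (d e : ι → R) (hde : ∀ i ∈ s, d i * e i = 1) {x y : R}
    (hQ : y ^ 2 + y = x ^ 3) {q : R⟦X⟧}
    (hq : X ^ 8 ∣ q - (X + C (x ^ 2) * X ^ 2 + C (1 + y ^ 2) * X ^ 4 + C (x ^ 4) * X ^ 6)) (φ : ι → R⟦X⟧)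
    (hφ : ∀ i ∈ s, φ i * (C (d i) + q) = 1) :
    coeff 4 (∑ i ∈ s, φ i) =
        (∑ i ∈ s, e i) ^ 2 * (y ^ 2 + 1) + (∑ i ∈ s, e i ^ 3) * x ^ 4 + (∑ i ∈ s, e i) ^ 4 * x ^ 2 + ∑ i ∈ s, e i ^ 5 ∧
      coeff 6 (∑ i ∈ s, φ i) =
        (∑ i ∈ s, e i) ^ 2 * x ^ 4 + (∑ i ∈ s, e i) ^ 4 * (y ^ 4 + 1) + (∑ i ∈ s, e i ^ 3) ^ 2 * x ^ 2 +
          ∑ i ∈ s, e i ^ 7 := by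
  have hq' : X ^ 8 ∣ q - (X + C (x ^ 2) * X ^ 2 + C (1 + y ^ 2) * X ^ 4 + C ((x ^ 2) ^ 2) * X ^ 6) := by
    rwa [show (x ^ 2) ^ 2 = x ^ 4 by ring]
  obtain ⟨h4, h6⟩ := jetEven_sum s d e hde hq' φ hφ
  have htwo : (2 : R) = 0 := CharTwo.two_eq_zero
  refine ⟨by rw [h4]; ring, ?_⟩
  rw [h6]
  linear_combination (-((∑ i ∈ s, e i) ^ 4 * (x ^ 3 + y ^ 2 + y))) * hQ +
    ((∑ i ∈ s, e i) ^ 4 * (y ^ 2 + y ^ 3)) * htwo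

end Summit.BirchSwinnertonDyer.BirchSwinnertonDyer.Theorems.SignedMuAtTwo.JetCharacterSums
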